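import Summits.QuantumFields.YangMills.Theorems.F4SubCurvatureDoorShortRootRigidityPlanarConicChart
import Literature.Analysis.Complex.LaplaceFourierCone
import Mathlib
import HarnessLib

/-!
# LINE g20-A «angular type» — step S2: exponential moments of the frame Laplace–Fourier measure (initial tube aperture)

Crux `F4SubCurvatureDoor.ShortRootRigidity` ⟨stmt-QuantumFields-23035⟩, registered skeleton `Cruxes/ShortRootRigidity/Lines/angular_type.lean`,
card `Lines/angular_type.md` §Hardest stub, step S2 of the plan for (C) `PlanarSpectralCone`.  For `k ∈ InPlanarClass` the rung R1⁺
(`…PlanarConicChartRegistered.planarConicChart` ✓) gives, at the ray point `(t, 0)`, a holomorphic extension of `s ↦ k(t, s)` to the disc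
`|s| < ct` bounded by any bound of `|k|` on `{‖y'‖ ≥ ct}`; Lukacs' theorem in the tree's form
`Literature.Analysis.Complex.integral_exp_le_of_laplaceFourier_eq_on_ball` turns this into EXPONENTIAL MOMENTS of every Laplace–Fourier
representing measure of the frame (the shape produced by `…PlanarLaplaceFourier.exists_planarLF` ✓): `∫ e^{-tE + βp} dμ ≤ 2M` for `|β| < ct`
(`planarExponentialMoments`) — i.e. the frame transform is holomorphic on the NARROW tube `{|Im σ| < c·Re ζ}` (aperture `c`; the bootstrap
`c → 1` is step S3, the XL content of (C), NOT done here).  The measure-theoretic transfer (`μ` may be infinite and asymmetric in `p`): tilt by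
`e^{-tE/2}`, symmetrise in `p`, push to `EuclideanSpace ℝ (Fin 2)` (`exists_symmetricLift`).

This file restates the owner's by-name rung `PlanarExponentialMoments` (`Lines/angular_type_rungs.lean`, appended 2026-08-29T11:26Z) CHARACTER-IDENTICALLY
and proves `planarExponentialMoments : PlanarExponentialMoments`.

HONEST LABEL: S2 only; (C) `PlanarSpectralCone` (S3–S4), (A), stub 4, ⟨23035⟩, ⟨23125⟩, R2d and
the Yang–Mills mass gap remain OPEN; no summit is proved by a line.
-/

noncomputable section

open MeasureTheory Filter Topology Set Metric Complex
open scoped BigOperators NNReal ENNReal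

namespace Summit.QuantumFields.YangMills.Theorems.F4SubCurvatureDoorPlanarExponentialMomentsRegistered

open Summit.QuantumFields.YangMills.Theorems.F4SubCurvatureDoorSliceDensityRegistered (E2)
open Summit.QuantumFields.YangMills.Theorems.F4SubCurvatureDoorSliceInClassRegistered (InPlanarClass)
open Summit.QuantumFields.YangMills.Theorems.F4SubCurvatureDoorPlanarLaplaceFourier
open Summit.QuantumFields.YangMills.Theorems.F4SubCurvatureDoorPlanarFrameTimeHolomorphyRegistered (mk2)
open Summit.QuantumFields.YangMills.Theorems.F4SubCurvatureDoorPlanarFrames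
open Summit.QuantumFields.YangMills.Theorems.F4SubCurvatureDoorPlanarConicChartRegistered (planarConicChart)

/-- S2 «INITIAL TUBE APERTURE / EXPONENTIAL MOMENTS» (size M given R1⁺; typed character-identically to the free hand's kernel-checked helper
`planarExponentialMoments`, INBOX 2026-08-29T11:12:40Z/11:17:00Z): every planar Laplace–Fourier representing measure of a frame of
`k ∈ InPlanarClass` has exponential moments of aperture `c` (the R1⁺ chart constant), bounded by twice any bound of `|k|` on `{‖y'‖ ≥ c t}`.
[problem-side rung; Lukacs via `Literature.Analysis.Complex.integral_exp_le_of_laplaceFourier_eq_on_ball`] -/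
def PlanarExponentialMoments : Prop := ∀ k : E2 → ℝ, InPlanarClass k → ∃ c : ℝ, 0 < c ∧ ∀ μ : Measure (ℝ × ℝ), μ (Set.Iio 0 ×ˢ Set.univ) = 0 → (∀ t : ℝ, 0 < t → Integrable (fun z : ℝ × ℝ => Real.exp (-(t * z.1))) μ ∧ ∀ x : ℝ, k (mk2 t x) = ∫ z, Real.exp (-(z.1 * t)) * Real.cos (z.2 * x) ∂μ) → ∀ t β : ℝ, 0 < t → |β| < c * t → Integrable (fun z : ℝ × ℝ => Real.exp (-(t * z.1) + β * z.2)) μ ∧ ∀ M : ℝ, (∀ y' : E2, c * t ≤ ‖y'‖ → |k y'| ≤ M) → ∫ z, Real.exp (-(t * z.1) + β * z.2) ∂μ ≤ 2 * M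

/-! ## The tilted, symmetrised lift of a planar measure to `EuclideanSpace ℝ (Fin 2)` -/

/-- **Symmetric finite lift.**  For a measure `μ` on `ℝ × ℝ` with `μ(E < 0) = 0` and `t > 0` with `e^{-tE/2}`, `e^{-tE}` integrable, there is a
FINITE measure `ν` on `EuclideanSpace ℝ (Fin 2)` carried by `p₀ ≥ 0` (the image of `e^{-tE/2}(μ + μ∘(p ↦ -p))`) whose Laplace–Fourier transform
at `(t/2, s)` is `2∫ e^{-tE} cos(ps) dμ`, and whose exponential moments dominate those of `e^{-tE}μ`. -/
theorem exists_symmetricLift (μ : Measure (ℝ × ℝ)) (hμ0 : μ (Iio 0 ×ˢ univ) = 0) (t : ℝ)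
    (hI : Integrable (fun z : ℝ × ℝ => Real.exp (-(t / 2 * z.1))) μ)
    (hI2 : Integrable (fun z : ℝ × ℝ => Real.exp (-(t * z.1))) μ) :
    ∃ ν : Measure (EuclideanSpace ℝ (Fin 2)), IsFiniteMeasure ν ∧ ν {p | p 0 < 0} = 0 ∧
      (∀ s : ℝ, ∫ p, cexp (-(((t / 2 : ℝ) : ℂ) * p 0) + I * (s : ℂ) * p 1) ∂ν
        = (((2 * ∫ z, Real.exp (-(z.1 * t)) * Real.cos (z.2 * s) ∂μ) : ℝ) : ℂ)) ∧
      ∀ β : ℝ, Integrable (fun p : EuclideanSpace ℝ (Fin 2) => Real.exp (-(t / 2 * p 0) + β * p 1)) ν →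
        Integrable (fun z : ℝ × ℝ => Real.exp (-(t * z.1) + β * z.2)) μ ∧
        ∫ z, Real.exp (-(t * z.1) + β * z.2) ∂μ ≤ ∫ p, Real.exp (-(t / 2 * p 0) + β * p 1) ∂ν := by
  -- the density, the flip and the identification `ℝ × ℝ ≃ EuclideanSpace ℝ (Fin 2)`
  set w : ℝ × ℝ → ℝ≥0 := fun z => (Real.exp (-(t / 2 * z.1))).toNNReal with hw
  have hwm : Measurable w := by fun_prop
  have hwval : ∀ z, (w z : ℝ) = Real.exp (-(t / 2 * z.1)) := fun z => Real.coe_toNNReal _ (Real.exp_pos _).le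
  set μt : Measure (ℝ × ℝ) := μ.withDensity fun z => (w z : ℝ≥0∞) with hμt
  have hμt_fin : IsFiniteMeasure μt := by
    refine isFiniteMeasure_withDensity (ne_of_lt ?_)
    have h := hI.2
    simp only [HasFiniteIntegral] at h
    refine lt_of_le_of_lt (le_of_eq (lintegral_congr fun z => ?_)) h
    rw [Real.enorm_eq_ofReal (Real.exp_pos _).le, ENNReal.ofReal]
  haveI := hμt_fin
  set flip : ℝ × ℝ ≃ᵐ ℝ × ℝ := MeasurableEquiv.prodCongr (MeasurableEquiv.refl ℝ) (MeasurableEquiv.neg ℝ) with hflip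
  have hflip_apply : ∀ z : ℝ × ℝ, flip z = (z.1, -z.2) := fun z => rfl
  set e : ℝ × ℝ ≃ᵐ EuclideanSpace ℝ (Fin 2) :=
    MeasurableEquiv.finTwoArrow.symm.trans (MeasurableEquiv.toLp 2 (Fin 2 → ℝ)) with he
  have he0 : ∀ z : ℝ × ℝ, e z 0 = z.1 := fun z => by simp [he]
  have he1 : ∀ z : ℝ × ℝ, e z 1 = z.2 := fun z => by simp [he]
  set μs : Measure (ℝ × ℝ) := μt + μt.map flip with hμs
  haveI : IsFiniteMeasure μs := by rw [hμs]; infer_instance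
  set ν : Measure (EuclideanSpace ℝ (Fin 2)) := μs.map e with hν
  haveI hνfin : IsFiniteMeasure ν := by rw [hν]; infer_instance
  -- integrals and integrability against ν
  have hinteg : ∀ {G : Type} [NormedAddCommGroup G] [NormedSpace ℝ G] (g : ℝ × ℝ → G),
      Integrable g μt ↔ Integrable (fun z => (w z : ℝ) • g z) μ := by
    intro G _ _ g
    rw [hμt, integrable_withDensity_iff_integrable_smul hwm]
    rfl
  have hinteg_flip : ∀ {G : Type} [NormedAddCommGroup G] [NormedSpace ℝ G] (g : ℝ × ℝ → G),
      Integrable g (μt.map flip) ↔ Integrable (fun z => (w z : ℝ) • g (flip z)) μ := by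
    intro G _ _ g
    rw [integrable_map_equiv flip g, hinteg]
    rfl
  have hinteg_ν : ∀ {G : Type} [NormedAddCommGroup G] [NormedSpace ℝ G] (f : EuclideanSpace ℝ (Fin 2) → G),
      Integrable f ν ↔ Integrable (fun z => (w z : ℝ) • f (e z)) μ ∧ Integrable (fun z => (w z : ℝ) • f (e (flip z))) μ := by
    intro G _ _ f
    rw [hν, integrable_map_equiv e f, hμs, integrable_add_measure, hinteg, hinteg_flip]
    rfl
  have hint : ∀ {G : Type} [NormedAddCommGroup G] [NormedSpace ℝ G] (f : EuclideanSpace ℝ (Fin 2) → G),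
      Integrable f ν →
      ∫ p, f p ∂ν = (∫ z, (w z : ℝ) • f (e z) ∂μ) + ∫ z, (w z : ℝ) • f (e (flip z)) ∂μ := by
    intro G _ _ f hf
    have hf' := hf
    rw [hν, integrable_map_equiv e f, hμs, integrable_add_measure] at hf'
    have h1 : Integrable (fun x => f (e x)) μt := hf'.1
    have h2 : Integrable (fun x => f (e x)) (μt.map flip) := hf'.2
    rw [hν, integral_map_equiv, hμs, integral_add_measure h1 h2, integral_map_equiv, hμt,
      integral_withDensity_eq_integral_smul hwm, integral_withDensity_eq_integral_smul hwm]
    rfl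
  have hmeas : ∀ {G : Type} [NormedAddCommGroup G] [NormedSpace ℝ G] [SecondCountableTopology G] [MeasurableSpace G]
      [BorelSpace G] (g : EuclideanSpace ℝ (Fin 2) → G), Continuous g → ∀ (φ : ℝ × ℝ → ℝ × ℝ), Measurable φ →
      AEStronglyMeasurable (fun z => (w z : ℝ) • g (e (φ z))) μ := fun g hg φ hφ =>
    ((measurable_coe_nnreal_real.comp hwm).smul (hg.measurable.comp (e.measurable.comp hφ))).aestronglyMeasurable
  refine ⟨ν, hνfin, ?_, ?_, ?_⟩
  · -- support
    have hms : MeasurableSet {p : EuclideanSpace ℝ (Fin 2) | p 0 < 0} :=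
      measurableSet_lt (by fun_prop) measurable_const
    rw [hν, Measure.map_apply e.measurable hms, hμs, Measure.add_apply,
      Measure.map_apply flip.measurable (hms.preimage e.measurable)]
    have e1 : e ⁻¹' {p : EuclideanSpace ℝ (Fin 2) | p 0 < 0} = Iio 0 ×ˢ univ := by
      ext z; simp [he0]
    have e2 : flip ⁻¹' (Iio (0 : ℝ) ×ˢ (univ : Set ℝ)) = Iio 0 ×ˢ univ := by
      ext z; simp [hflip_apply]
    rw [e1, e2, hμt, withDensity_absolutelyContinuous μ _ hμ0, add_zero]
  · -- the transform at real momenta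
    intro s
    set f : EuclideanSpace ℝ (Fin 2) → ℂ := fun p => cexp (-(((t / 2 : ℝ) : ℂ) * p 0) + I * (s : ℂ) * p 1) with hf
    have hfc : Continuous f := by rw [hf]; fun_prop
    have hfe : ∀ z : ℝ × ℝ, (w z : ℝ) • f (e z)
        = ((Real.exp (-(z.1 * t)) : ℝ) : ℂ) * cexp (((z.2 * s : ℝ) : ℂ) * I) := by
      intro z
      rw [hwval, hf]; dsimp only
      rw [he0, he1, Complex.real_smul, Complex.ofReal_exp, Complex.ofReal_exp, ← Complex.exp_add, ← Complex.exp_add]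
      push_cast; ring_nf
    have hfef : ∀ z : ℝ × ℝ, (w z : ℝ) • f (e (flip z))
        = ((Real.exp (-(z.1 * t)) : ℝ) : ℂ) * cexp (((-(z.2 * s) : ℝ) : ℂ) * I) := by
      intro z
      rw [hwval, hf, hflip_apply]; dsimp only
      rw [he0, he1, Complex.real_smul, Complex.ofReal_exp, Complex.ofReal_exp, ← Complex.exp_add, ← Complex.exp_add]
      push_cast; ring_nf
    have hI2' : Integrable (fun z : ℝ × ℝ => Real.exp (-(z.1 * t))) μ :=
      hI2.congr (Eventually.of_forall fun z => by simp [mul_comm])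
    have hn1 : ∀ z : ℝ × ℝ, ‖(w z : ℝ) • f (e z)‖ ≤ Real.exp (-(z.1 * t)) := fun z => by
      rw [hfe, norm_mul, Complex.norm_exp_ofReal_mul_I, mul_one, Complex.norm_real, Real.norm_eq_abs,
        abs_of_pos (Real.exp_pos _)]
    have hn2 : ∀ z : ℝ × ℝ, ‖(w z : ℝ) • f (e (flip z))‖ ≤ Real.exp (-(z.1 * t)) := fun z => by
      rw [hfef, norm_mul, Complex.norm_exp_ofReal_mul_I, mul_one, Complex.norm_real, Real.norm_eq_abs,
        abs_of_pos (Real.exp_pos _)]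
    have h1 : Integrable (fun z => (w z : ℝ) • f (e z)) μ :=
      hI2'.mono' (hmeas f hfc id measurable_id) (Eventually.of_forall hn1)
    have h2 : Integrable (fun z => (w z : ℝ) • f (e (flip z))) μ :=
      hI2'.mono' (hmeas f hfc flip flip.measurable) (Eventually.of_forall hn2)
    have hfi : Integrable f ν := (hinteg_ν f).2 ⟨h1, h2⟩
    rw [hint f hfi, ← integral_add h1 h2]
    have hpt : ∀ z : ℝ × ℝ, (w z : ℝ) • f (e z) + (w z : ℝ) • f (e (flip z))
        = (((2 * (Real.exp (-(z.1 * t)) * Real.cos (z.2 * s))) : ℝ) : ℂ) := by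
      intro z
      rw [hfe, hfef, ← mul_add]
      have h2 : cexp (((z.2 * s : ℝ) : ℂ) * I) + cexp (((-(z.2 * s) : ℝ) : ℂ) * I) = 2 * ((Real.cos (z.2 * s) : ℝ) : ℂ) := by
        rw [Complex.ofReal_cos, Complex.cos]
        push_cast
        ring_nf
      rw [h2]
      push_cast
      ring
    simp_rw [hpt]
    rw [integral_complex_ofReal, integral_const_mul]
  · -- exponential moments
    intro β hβ
    set g : EuclideanSpace ℝ (Fin 2) → ℝ := fun p => Real.exp (-(t / 2 * p 0) + β * p 1) with hg
    obtain ⟨h1, h2⟩ := (hinteg_ν g).1 hβ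
    have hge : ∀ z : ℝ × ℝ, (w z : ℝ) • g (e z) = Real.exp (-(t * z.1) + β * z.2) := by
      intro z
      rw [hwval, hg]; dsimp only
      rw [he0, he1, smul_eq_mul, ← Real.exp_add]
      congr 1; ring
    have hgef : ∀ z : ℝ × ℝ, 0 ≤ (w z : ℝ) • g (e (flip z)) := fun z => by
      rw [smul_eq_mul]; exact mul_nonneg (w z).2 (Real.exp_pos _).le
    constructor
    · exact h1.congr (Eventually.of_forall hge)
    · rw [hint g hβ]
      have e1 : ∫ z, (w z : ℝ) • g (e z) ∂μ = ∫ z, Real.exp (-(t * z.1) + β * z.2) ∂μ :=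
        integral_congr_ae (Eventually.of_forall hge)
      rw [e1]
      have : 0 ≤ ∫ z, (w z : ℝ) • g (e (flip z)) ∂μ := integral_nonneg fun z => hgef z
      linarith

/-! ## Exponential moments from the conic chart -/

/-- **S2 · exponential moments of aperture `c` (initial tube aperture).**  For `k ∈ InPlanarClass` there is `c > 0` such that every
Laplace–Fourier representing measure `μ` of the frame (`μ(E < 0) = 0`, `∫e^{-tE}dμ < ∞`, `k(t, x) = ∫ e^{-tE} cos(px) dμ` for `t > 0`) has
exponential moments `∫ e^{-tE + βp} dμ ≤ 2M` for all `t > 0`, `|β| < ct` and every bound `M` of `|k|` on `{‖y'‖ ≥ ct}`. -/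
theorem planarExponentialMoments_of (k : E2 → ℝ) (hk : InPlanarClass k) :
    ∃ c : ℝ, 0 < c ∧ ∀ μ : Measure (ℝ × ℝ), μ (Iio 0 ×ˢ univ) = 0 →
      (∀ t : ℝ, 0 < t → Integrable (fun z : ℝ × ℝ => Real.exp (-(t * z.1))) μ ∧
        ∀ x : ℝ, k (mk2 t x) = ∫ z, Real.exp (-(z.1 * t)) * Real.cos (z.2 * x) ∂μ) →
      ∀ t β : ℝ, 0 < t → |β| < c * t →
        Integrable (fun z : ℝ × ℝ => Real.exp (-(t * z.1) + β * z.2)) μ ∧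
        ∀ M : ℝ, (∀ y' : E2, c * t ≤ ‖y'‖ → |k y'| ≤ M) → ∫ z, Real.exp (-(t * z.1) + β * z.2) ∂μ ≤ 2 * M := by
  obtain ⟨c, hc, hchart⟩ := planarConicChart k hk
  obtain ⟨hcont, ⟨C, hC⟩, -, -, -, -, -⟩ := hk
  refine ⟨c, hc, fun μ hμ0 hμ t β ht hβ => ?_⟩
  -- the chart at the ray point `(t, 0)`
  have hy0 : mk2 t 0 0 = t := mk2_zero _ _
  have hy1 : mk2 t 0 1 = 0 := mk2_one _ _
  have hyn : ‖mk2 t 0‖ = t := by rw [norm_mk2_axis, abs_of_pos ht]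
  have hy : mk2 t 0 ≠ 0 := mk_ne_zero_left 0 ht.ne'
  obtain ⟨F, hFd, hFreal, hFbd⟩ := hchart (mk2 t 0) hy
  rw [hy0, hy1, hyn] at hFd hFreal hFbd
  -- the symmetric lift
  obtain ⟨ν, hνfin, hν0, hνtr, hνmom⟩ := exists_symmetricLift μ hμ0 t (hμ (t / 2) (half_pos ht)).1 (hμ t ht).1
  haveI := hνfin
  -- Lukacs for one admissible bound
  have key : ∀ M : ℝ, (∀ y' : E2, c * t ≤ ‖y'‖ → |k y'| ≤ M) →
      Integrable (fun z : ℝ × ℝ => Real.exp (-(t * z.1) + β * z.2)) μ ∧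
        ∫ z, Real.exp (-(t * z.1) + β * z.2) ∂μ ≤ 2 * M := by
    intro M hM
    have hmaps : MapsTo (fun σ : ℂ => (((t : ℝ) : ℂ), σ)) (ball (0 : ℂ) (c * t))
        (ball ((((t : ℝ) : ℂ), (((0 : ℝ) : ℝ) : ℂ)) : ℂ × ℂ) (c * t)) := by
      intro σ hσ
      rw [mem_ball, dist_zero_right] at hσ
      rw [mem_ball, Prod.dist_eq, dist_self, Complex.ofReal_zero, dist_zero_right]
      exact max_lt (by positivity) hσ
    have hh : DifferentiableOn ℂ (fun σ : ℂ => 2 * F (((t : ℝ) : ℂ), σ)) (ball (0 : ℂ) (c * t)) :=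
      ((hFd.comp (by fun_prop : Differentiable ℂ fun σ : ℂ => (((t : ℝ) : ℂ), σ)).differentiableOn hmaps)).const_mul 2
    have hhM : ∀ z ∈ ball (0 : ℂ) (c * t), ‖2 * F (((t : ℝ) : ℂ), z)‖ ≤ 2 * M := by
      intro z hz
      rw [norm_mul, Complex.norm_two]
      exact mul_le_mul_of_nonneg_left (hFbd M hM _ (hmaps hz)) zero_le_two
    have heq : ∀ s : ℝ, |s| < c * t →
        2 * F (((t : ℝ) : ℂ), (s : ℂ)) = ∫ p, cexp (-(((t / 2 : ℝ) : ℂ) * p 0) + I * (s : ℂ) * p 1) ∂ν := by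
      intro s hs
      rw [hνtr s, hFreal t s (by rw [sub_self, abs_zero]; positivity) (by rw [sub_zero]; exact hs), (hμ t ht).2 s]
      push_cast; ring
    obtain ⟨hint, hle⟩ := Literature.Analysis.Complex.integral_exp_le_of_laplaceFourier_eq_on_ball hν0 (half_pos ht).le
      (by positivity : 0 < c * t) hh hhM heq hβ
    obtain ⟨hintμ, hleμ⟩ := hνmom β hint
    exact ⟨hintμ, hleμ.trans hle⟩
  -- an admissible bound exists (unit-disc bound + compact annulus)
  obtain ⟨M₀, hM₀⟩ : ∃ M₀ : ℝ, ∀ y' : E2, c * t ≤ ‖y'‖ → |k y'| ≤ M₀ := by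
    set A : Set E2 := {z | c * t ≤ ‖z‖} ∩ closedBall 0 1 with hA
    have hAc : IsCompact A :=
      (isCompact_closedBall (0 : E2) 1).of_isClosed_subset
        ((isClosed_le continuous_const continuous_norm).inter isClosed_closedBall) Set.inter_subset_right
    have hA0 : A ⊆ {z | z ≠ 0} := by
      intro z hz hz0
      have h1 : c * t ≤ ‖z‖ := hz.1
      rw [hz0, norm_zero] at h1
      have : 0 < c * t := by positivity
      linarith
    obtain ⟨M₁, hM₁⟩ := hAc.exists_bound_of_continuousOn (hcont.mono hA0)
    refine ⟨max C M₁, fun y' hy' => ?_⟩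
    rcases le_or_gt 1 ‖y'‖ with h1 | h1
    · exact (hC y' h1).trans (le_max_left _ _)
    · have := hM₁ y' ⟨hy', by rw [mem_closedBall, dist_zero_right]; exact h1.le⟩
      rw [Real.norm_eq_abs] at this
      exact this.trans (le_max_right _ _)
  exact ⟨(key M₀ hM₀).1, fun M hM => (key M hM).2⟩

/-- **RUNG S2 (by name): `PlanarExponentialMoments`.** -/
theorem planarExponentialMoments : PlanarExponentialMoments := fun k hk => planarExponentialMoments_of k hk

end Summit.QuantumFields.YangMills.Theorems.F4SubCurvatureDoorPlanarExponentialMomentsRegistered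

end
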